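import Mathlib
import HarnessLib
import Summits.HubbardSuperconductivity.HubbardSuperconductivity.Theorems.KLProgrammeKLRegimeEngineTowerLevelsReadoutSups
import Summits.HubbardSuperconductivity.HubbardSuperconductivity.Theorems.KLProgrammeKLRegimeEngineTowerModelDefsRate
import Summits.HubbardSuperconductivity.HubbardSuperconductivity.Theorems.KLProgrammeKLRegimeEngineWtBudget

/-!
# Route `KLProgramme` — crux K3, VL child stmt-HubbardSuperconductivity-23356 (`KLRegimeVolumeLimitV17F3`, v12W-9) / ENGINE stub (b) (ℓ): the INPUT read-out row
# «ROW-T» at a read-out level from the tower's THREE-PART decomposition with suprema over pins — the (I6)-twin entry point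
# (cell gate-hubbard-kl, seat hubbard-kl-k3c4-p1 g21, VL lead; located «(VL)-HE1FREE-SUPPLY», memo HE1FREE-SUPPLY-g21.md §3; pen (R337)(C2))

E1's glue `…EngineTowerLevelsReadoutSups.kernelNormsWt4_klWtBudget_of_towerSups` reads (b)'s weighted clause at level `j` — the action `𝒱_j[K]` at family `F_j` —
off the three-part decomposition `𝒱_j = 𝒱_0 + Σ_{k<j/d} Δ_k + (𝒱_j − 𝒱_{d(j/d)})`.  The VL child's last atom (`stub_vl_HE1free′`, via ROW-T) reads the INPUT
`𝒱_{j+1}[K]` at the COARSER family `F_j` with rate `j` (`klWtPinnedSumAt … j j m (𝒱_{j+1}[K])`): the same glue with the decomposition taken at index `j + 1`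
and every summand measured at `F_j`:

* `klWtPinnedSumOf_klEffectiveAction_le_three_parts` — GENERIC element index `i` and family `J`: `klWtPinnedSumOf … J m (𝒱_i[K]) q w ≤` the three-part sum at `(J, i, d)`;
* **`inputReadoutWt_of_towerSups`** — if, for every `p ≥ 2`, the three suprema (UV part, block increments `k < (j+1)/d`, partial block `𝒱_{j+1} − 𝒱_{d((j+1)/d)}`,
  all measured at `F_j`) fit under `C₀·klWtBudget P Q U (j+1) (2p)`, then ROW-T's law clause at level `j`:
  `∀ p ≥ 2, ∀ q w, klWtPinnedSumAt … K j j (2p) (𝒱_{j+1}[K]) q w ≤ C₀·klWtBudget P Q U (j+1) (2p)`;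
* **`inputReadoutWt_two_of_towerSups`** — the degree-`2` clause likewise, under any right-hand side `S₂` (ROW-T: `S₂ := C₀·Q.CE·ε_n·4^{−(j+1)}`).
So the E-lane's (I6)-twin for ROW-T is: FIT THREE NUMBERS per level under the budget at target `F_j` — re-measured UV datum, re-measured block increments (jump
`j − dk ≥ 0`), the partial block's born size — exactly as for (b), one notch coarser.  Pure bookkeeping over E1's carriers; nothing about the model is asserted;
nothing asserts ROW-T, (ℓ), any stub, VL, K3 or superconductivity.
References: BGM 2006 §2.8 (2.76)–(2.77), (2.83) [cite: BenfattoGiulianiMastropietro2006].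
-/

noncomputable section

namespace Summit.HubbardSuperconductivity.HubbardSuperconductivity.Theorems.EngineV8

set_option linter.dupNamespace false -- summit = problem name (single-conjunct summit), D-0017

open Real Finset Literature.MathematicalPhysics.QuantumLattice Literature.Probability.LatticeModels
open Literature.MathematicalPhysics.QuantumLattice.FermiRG
open Summit.HubbardSuperconductivity.HubbardSuperconductivity.Theorems.KLRegimeSplit
open Summit.HubbardSuperconductivity.HubbardSuperconductivity.Theorems.KLProgrammeLegKernels
open Summit.HubbardSuperconductivity.HubbardSuperconductivity.Theorems.DispersionFlow

variable {L M : ℕ} [NeZero L]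

/-- **Pointwise, weighted, GENERIC element and family**: every family-`J` weighted pinned sum of the scale-`i` action `𝒱_i[K]` is at most the three-part sum of the
pinned sums of `𝒱_0`, of the block increments `Δ_k`, `k < i/d`, and of the partial block `𝒱_i − 𝒱_{d(i/d)}`, all at family `J`.
[cite: BenfattoGiulianiMastropietro2006, §2.8 (2.83)] -/
theorem klWtPinnedSumOf_klEffectiveAction_le_three_parts {β : ℝ} (hβ : 0 ≤ β) (U μ : ℝ) (K : TrigPolyC4v) (d J i m : ℕ) (q : Fin m)
    (w : SpaceTimeIdx L M × SectorLeg (sectorCount J)) :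
    klWtPinnedSumOf L M β μ K J m (klEffectiveAction L M β U μ K klE0 i) q w ≤
      klWtPinnedSumOf L M β μ K J m (klEffectiveAction L M β U μ K klE0 0) q w +
        ∑ k ∈ range (i / d), klWtPinnedSumOf L M β μ K J m (klTowerIncr L M β U μ K d k) q w +
          klWtPinnedSumOf L M β μ K J m (klEffectiveAction L M β U μ K klE0 i - klTowerInput L M β U μ K d (i / d)) q w := by
  conv_lhs => rw [klEffectiveAction_eq_uv_add_incr_add_partial β U μ K d i]
  refine (klWtPinnedSumOf_add_le hβ μ K J m _ _ q w).trans (add_le_add ?_ le_rfl)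
  exact (klWtPinnedSumOf_add_le hβ μ K J m _ _ q w).trans (add_le_add le_rfl (klWtPinnedSumOf_sum_le hβ μ K J m _ _ q w))

/-- Every family-`J` weighted pinned sum of `T` is at most its supremum over pins. [folklore] -/
theorem klWtPinnedSumOf_le_ciSup (β μ : ℝ) (K : TrigPolyC4v) (J m : ℕ) (T : HubbardGrassmann L M) (q : Fin m)
    (w : SpaceTimeIdx L M × SectorLeg (sectorCount J)) :
    klWtPinnedSumOf L M β μ K J m T q w ≤
      ⨆ qw : Fin m × (SpaceTimeIdx L M × SectorLeg (sectorCount J)), klWtPinnedSumOf L M β μ K J m T qw.1 qw.2 :=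
  le_ciSup (f := fun qw : Fin m × (SpaceTimeIdx L M × SectorLeg (sectorCount J)) => klWtPinnedSumOf L M β μ K J m T qw.1 qw.2)
    (Set.finite_range _).bddAbove (q, w)

/-- **ROW-T's LAW CLAUSE AT ONE LEVEL FROM THE TOWER'S THREE-PART SUPREMA** (the (I6)-twin for the VL atom): if, in every degree `2p ≥ 4`, the suprema over
pins at family `F_j` of the weighted pinned sums of `𝒱_0`, of the block increments `Δ_k` (`k < (j+1)/d`) and of the partial block `𝒱_{j+1} − 𝒱_{d((j+1)/d)}` fit
under `C₀·klWtBudget P Q U (j+1) (2p)`, then the input `𝒱_{j+1}[K]` read at `(F_j, rate j)` obeys that law at every pin.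
[cite: BenfattoGiulianiMastropietro2006, §2.8 (2.77), (2.83)] -/
theorem inputReadoutWt_of_towerSups {β : ℝ} (hβ : 0 ≤ β) {U μ : ℝ} {K : TrigPolyC4v} {d j : ℕ} {P : SplitConsts} {Q : EngConsts} {C₀ : ℝ}
    (hfit : ∀ p : ℕ, 2 ≤ p →
      (⨆ qw : Fin (2 * p) × (SpaceTimeIdx L M × SectorLeg (sectorCount j)),
          klWtPinnedSumOf L M β μ K j (2 * p) (klEffectiveAction L M β U μ K klE0 0) qw.1 qw.2) +
        ∑ k ∈ range ((j + 1) / d), (⨆ qw : Fin (2 * p) × (SpaceTimeIdx L M × SectorLeg (sectorCount j)),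
          klWtPinnedSumOf L M β μ K j (2 * p) (klTowerIncr L M β U μ K d k) qw.1 qw.2) +
        (⨆ qw : Fin (2 * p) × (SpaceTimeIdx L M × SectorLeg (sectorCount j)),
          klWtPinnedSumOf L M β μ K j (2 * p) (klEffectiveAction L M β U μ K klE0 (j + 1) - klTowerInput L M β U μ K d ((j + 1) / d)) qw.1 qw.2) ≤
        C₀ * klWtBudget P Q U (j + 1) (2 * p)) :
    ∀ p : ℕ, 2 ≤ p → ∀ (q : Fin (2 * p)) (w : SpaceTimeIdx L M × SectorLeg (sectorCount j)),
      klWtPinnedSumAt L M β μ K j j (2 * p) (klEffectiveAction L M β U μ K klE0 (j + 1)) q w ≤ C₀ * klWtBudget P Q U (j + 1) (2 * p) := by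
  intro p hp q w
  rw [klWtPinnedSumAt_self]
  refine (klWtPinnedSumOf_klEffectiveAction_le_three_parts hβ U μ K d j (j + 1) (2 * p) q w).trans (le_trans ?_ (hfit p hp))
  exact add_le_add (add_le_add (klWtPinnedSumOf_le_ciSup β μ K j _ _ q w)
    (sum_le_sum fun k _ => klWtPinnedSumOf_le_ciSup β μ K j _ _ q w)) (klWtPinnedSumOf_le_ciSup β μ K j _ _ q w)

/-- **ROW-T's DEGREE-2 CLAUSE AT ONE LEVEL FROM THE TOWER'S THREE-PART SUPREMA**, under any right-hand side `S₂`
(ROW-T at scale `n`: `S₂ := C₀·Q.CE·epsCoupling P U n·((4:ℝ)^(j+1))⁻¹`). [cite: BenfattoGiulianiMastropietro2006, §2.8 (2.77), (2.83)] -/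
theorem inputReadoutWt_two_of_towerSups {β : ℝ} (hβ : 0 ≤ β) {U μ : ℝ} {K : TrigPolyC4v} {d j : ℕ} {S₂ : ℝ}
    (hfit :
      (⨆ qw : Fin 2 × (SpaceTimeIdx L M × SectorLeg (sectorCount j)),
          klWtPinnedSumOf L M β μ K j 2 (klEffectiveAction L M β U μ K klE0 0) qw.1 qw.2) +
        ∑ k ∈ range ((j + 1) / d), (⨆ qw : Fin 2 × (SpaceTimeIdx L M × SectorLeg (sectorCount j)),
          klWtPinnedSumOf L M β μ K j 2 (klTowerIncr L M β U μ K d k) qw.1 qw.2) +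
        (⨆ qw : Fin 2 × (SpaceTimeIdx L M × SectorLeg (sectorCount j)),
          klWtPinnedSumOf L M β μ K j 2 (klEffectiveAction L M β U μ K klE0 (j + 1) - klTowerInput L M β U μ K d ((j + 1) / d)) qw.1 qw.2) ≤ S₂) :
    ∀ (q : Fin 2) (w : SpaceTimeIdx L M × SectorLeg (sectorCount j)),
      klWtPinnedSumAt L M β μ K j j 2 (klEffectiveAction L M β U μ K klE0 (j + 1)) q w ≤ S₂ := by
  intro q w
  rw [klWtPinnedSumAt_self]
  refine (klWtPinnedSumOf_klEffectiveAction_le_three_parts hβ U μ K d j (j + 1) 2 q w).trans (le_trans ?_ hfit)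
  exact add_le_add (add_le_add (klWtPinnedSumOf_le_ciSup β μ K j _ _ q w)
    (sum_le_sum fun k _ => klWtPinnedSumOf_le_ciSup β μ K j _ _ q w)) (klWtPinnedSumOf_le_ciSup β μ K j _ _ q w)

end Summit.HubbardSuperconductivity.HubbardSuperconductivity.Theorems.EngineV8

end
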